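import Mathlib
import Literature.NumberTheory.EllipticCurves.IwasawaAlgebra

/-!
# STUB-IDEAS k1 (gen 26) for `stub_heegnerIndexLowerAtTwo` — «UNIT GRADE SUFFICES»: the weakest sufficient
# form of road RT⁺'s two IDENTIFICATION residues (R175 at node (2)₂; R188 / R189 at node (3)₂)

Scratch certificate of seat `sidea-stub_heegnerIndexLowerAtTwo-1-g26` (planner, stub-ideation, technique family
«weaken / strengthen»; NOT a proposal — published as a crux workfile and attached as evidence on
stmt-BirchSwinnertonDyer-27851).  THEOREMS ONLY (generic algebra of power series, units and norms, valuation
shadows over `ℤ`); no `sorry`, no new definitions, no named facts; NOTHING is asserted about BSD, about the crux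
`PrintCf2.SplitBadTwoLowerHalfOfFacts`, about the stub, about S2′ or about any node law — none of them is proved here.

THE LEVER.  Road RT⁺ consumes the Λ-adic identifications «Coleman image of the elliptic-unit class = the
member's measure» only through NORMS (B25) of (i) ONE out-of-range VALUE per member (node (2)₂) and (ii) the
FIRST Taylor coefficient at `𝟙` of the cyclotomic line (node (3)₂).  A unit `U ∈ Λˣ` evaluates to a `p`-adic
unit under every `𝒪`-valued ring hom (§2), and — because the member has analytic rank one, so the zeroth Taylor
coefficient of its measure VANISHES — rescaling by `U` multiplies the first Taylor coefficient by the unit `U(𝟙)`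
(§1, `coeff_one_mul_of_constantCoeff_eq_zero`; order-`r` version `coeff_mul_of_coeff_lt_eq_zero`).  Hence both
residues may be weakened from EQUALITIES `Col(u_W) = 𝓛_W` to ASSOCIATEDNESS `Col(u_W) ∈ Λˣ·𝓛_W` with a
MEMBER-DEPENDENT unit (§3–§4: the norm laws of k3-g26 / k2-g25 survive verbatim), i.e. to the ideal currency in
which the printed sources speak (de Shalit 1987 III.1.4 (5) `i(𝒞_𝔣 ⊗̂ D) = μ(𝔣)Λ₀`; II.4.12: `μ_𝔞 = 12·δ_𝔞·μ(𝔣)`).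
§5 records the honest ONE-SIDED weakest form (divisibility ⟹ the inequality the LOWER half consumes) and the
two-divisibilities ⟹ unit-grade converse; §6 the keyed digit shadows and the budget transport between χ₅-partner
keys; §7 anti-costume witnesses (each hypothesis of §1–§2 is load-bearing).
-/

-- the summit namespace `Summit.BirchSwinnertonDyer.BirchSwinnertonDyer` repeats the problem name by design (D-0017)
set_option linter.dupNamespace false
set_option autoImplicit false

namespace Summit.BirchSwinnertonDyer.BirchSwinnertonDyer.Cruxes.SplitBadTwoLowerHalfOfFacts.StubIdeasK1G26

open PowerSeries

/-! ## §1  The rank-one Taylor lemma (pure algebra of `R⟦X⟧`, `X = γ − 1`) -/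
section Taylor

variable {R : Type*} [CommRing R]

/-- Leibniz rule at `𝟙`: `[T¹](a·b) = a(𝟙)·[T¹]b + [T¹]a·b(𝟙)`. -/
theorem coeff_one_mul (a b : R⟦X⟧) :
    coeff 1 (a * b) = constantCoeff a * coeff 1 b + coeff 1 a * constantCoeff b := by
  rw [coeff_mul, Finset.Nat.sum_antidiagonal_eq_sum_range_succ_mk, Finset.sum_range_succ,
    Finset.sum_range_succ, Finset.sum_range_zero]
  simp

/-- **H1 (rank one).** If the zeroth Taylor coefficient of `f` vanishes (`𝓛_W(𝟙) = 0`: the member has analytic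
rank ≥ 1), then rescaling `f` by ANY power series `U` multiplies the first Taylor coefficient by `U(𝟙)`:
`[T¹](U·f) = U(𝟙)·[T¹]f`.  With `U ∈ Λˣ`, `U(𝟙)` is a unit (§2), so `‖[T¹](U·f)‖ = ‖[T¹]f‖`. -/
theorem coeff_one_mul_of_constantCoeff_eq_zero (U f : R⟦X⟧) (hf : constantCoeff f = 0) :
    coeff 1 (U * f) = constantCoeff U * coeff 1 f := by
  rw [coeff_one_mul, hf, mul_zero, add_zero]

/-- **H1ʳ (analytic rank `r`).** If all Taylor coefficients of `f` below `r` vanish, the `r`-th one is rescaled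
by `U(𝟙)` only: `[Tʳ](U·f) = U(𝟙)·[Tʳ]f` — the leading term is «well defined up to a `p`-adic unit». -/
theorem coeff_mul_of_coeff_lt_eq_zero (U f : R⟦X⟧) (r : ℕ) (hf : ∀ i < r, coeff i f = 0) :
    coeff r (U * f) = constantCoeff U * coeff r f := by
  rw [coeff_mul, Finset.Nat.sum_antidiagonal_eq_sum_range_succ_mk]
  rw [Finset.sum_eq_single 0]
  · simp
  · intro k hk hk0
    have hkr : k ≤ r := Nat.lt_succ_iff.mp (Finset.mem_range.mp hk)
    have : coeff (r - k) f = 0 := hf (r - k) (by omega)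
    rw [this, mul_zero]
  · intro h
    exact absurd (Finset.mem_range.mpr (Nat.succ_pos r)) h

/-- The unit class is transitive bookkeeping: rescaling twice by `U`, `V` rescales the leading coefficient by
`U(𝟙)·V(𝟙)` (member-dependent units compose; nothing key-uniform is required of them). -/
theorem coeff_one_mul_mul_of_constantCoeff_eq_zero (U V f : R⟦X⟧) (hf : constantCoeff f = 0) :
    coeff 1 (U * (V * f)) = constantCoeff U * constantCoeff V * coeff 1 f := by
  have hVf : constantCoeff (V * f) = 0 := by rw [map_mul, hf, mul_zero]
  rw [coeff_one_mul_of_constantCoeff_eq_zero U _ hVf, coeff_one_mul_of_constantCoeff_eq_zero V f hf, mul_assoc]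

end Taylor

/-! ## §2  Units evaluate to norm one (any `𝒪`-valued ring hom; `𝒪` an integrally normed ring such as `ℤ_[2]`,
`𝒪_{ℂ₂}`, the Witt vectors of `𝔽̄₂`) -/
section UnitNorm

variable {𝒪 : Type*} [NormedCommRing 𝒪] [NormOneClass 𝒪] [NormMulClass 𝒪]

/-- **H2.** In a multiplicatively normed ring all of whose elements have norm `≤ 1`, units have norm `1`. -/
theorem norm_eq_one_of_isUnit (hint : ∀ x : 𝒪, ‖x‖ ≤ 1) {u : 𝒪} (hu : IsUnit u) : ‖u‖ = 1 := by
  obtain ⟨v, hv⟩ := hu.exists_right_inv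
  have h1 : ‖u‖ * ‖v‖ = 1 := by rw [← norm_mul, hv, norm_one]
  have hu1 := hint u
  have hv1 := hint v
  nlinarith [norm_nonneg u, norm_nonneg v]

/-- **H2′.** A unit of ANY commutative ring `Λ` (an Iwasawa algebra in one or two variables, with any integral
coefficients) is sent to a norm-one element by EVERY ring hom into such an `𝒪` — evaluation at an in-range or
out-of-range character, augmentation, restriction to a line followed by evaluation, … -/
theorem norm_map_eq_one_of_isUnit {Λ : Type*} [CommRing Λ] (φ : Λ →+* 𝒪) (hint : ∀ x : 𝒪, ‖x‖ ≤ 1)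
    {U : Λ} (hU : IsUnit U) : ‖φ U‖ = 1 :=
  norm_eq_one_of_isUnit hint (hU.map φ)

/-- Value node at unit grade: `‖φ(U·L)‖ = ‖φ L‖`. -/
theorem norm_map_mul_of_isUnit {Λ : Type*} [CommRing Λ] (φ : Λ →+* 𝒪) (hint : ∀ x : 𝒪, ‖x‖ ≤ 1)
    {U : Λ} (hU : IsUnit U) (L : Λ) : ‖φ (U * L)‖ = ‖φ L‖ := by
  rw [map_mul, norm_mul, norm_map_eq_one_of_isUnit φ hint hU, one_mul]

/-- Instance of record: `Λ = ℤ₂⟦T⟧` (`IwasawaAlgebra 2`), augmentation = constant coefficient. -/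
example {U : Literature.NumberTheory.EllipticCurves.IwasawaAlgebra 2} (hU : IsUnit U) :
    ‖PowerSeries.constantCoeff U‖ = 1 :=
  norm_map_eq_one_of_isUnit PowerSeries.constantCoeff PadicInt.norm_le_one hU

end UnitNorm

/-! ## §3  Node (3)₂ at unit grade: k3-g26's key-uniform law survives `klf` ↦ `klf up to Λˣ`
Abstract frame: `Λ` (Iwasawa algebra of the key's tower, any coefficients), `aug : Λ →+* 𝒪` (evaluation at `𝟙`),
`ι : 𝒪 →+* F` norm-preserving into the value field, `D : Λ → F` a derivation AT `𝟙` (`[T¹]`, or `d/ds` at `s = 0`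
after `T = γ^s − 1`; Leibniz `D(ab) = a(𝟙)·Db + Da·b(𝟙)`). -/
section NodeThree

variable {Λ 𝒪 F : Type*} [CommRing Λ] [NormedCommRing 𝒪] [NormOneClass 𝒪] [NormMulClass 𝒪] [NormedField F]
variable (aug : Λ →+* 𝒪) (ι : 𝒪 →+* F) (D : Λ → F)

omit [NormOneClass 𝒪] [NormMulClass 𝒪] in
/-- Leibniz at `𝟙` + vanishing at `𝟙` ⟹ `D(U·L) = U(𝟙)·D L`. -/
theorem deriv_mul_of_aug_eq_zero (hD : ∀ a b : Λ, D (a * b) = ι (aug a) * D b + D a * ι (aug b))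
    (U L : Λ) (hL : aug L = 0) : D (U * L) = ι (aug U) * D L := by
  rw [hD, hL, map_zero, mul_zero, add_zero]

/-- **H3.** `‖D(U·L)‖ = ‖D L‖` for `U ∈ Λˣ` and `L(𝟙) = 0` (analytic rank one). -/
theorem norm_deriv_mul_of_isUnit (hD : ∀ a b : Λ, D (a * b) = ι (aug a) * D b + D a * ι (aug b))
    (hι : ∀ x : 𝒪, ‖ι x‖ = ‖x‖) (hint : ∀ x : 𝒪, ‖x‖ ≤ 1) {U : Λ} (hU : IsUnit U) (L : Λ) (hL : aug L = 0) :
    ‖D (U * L)‖ = ‖D L‖ := by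
  rw [deriv_mul_of_aug_eq_zero aug ι D hD U L hL, norm_mul, hι, norm_map_eq_one_of_isUnit aug hint hU, one_mul]

/-- **GLUE (3)₂ at unit grade** — the binder shapes of k3-g26's `threeTwo_keyUniform_of_cut` with its residue
`klf : ∀ i, Col (u i) = 𝓛 i` WEAKENED to `klfU : ∀ i, Col (u i) = U i * 𝓛 i`, `U i ∈ Λˣ` MEMBER-DEPENDENT:
the key-uniform law `∃ ε, ∀ W ∈ key, λ_W·hyy_W = ε·(ℓγ·[T¹]Col(u_W))·log_ω y_W` (ε outside ∀ W) still yields the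
NORM law in the member's measure `‖λ_W‖·‖hyy_W‖ = ‖ε‖·‖ℓγ·𝓛′_W‖·‖log_ω y_W‖` — because `𝓛_W(𝟙) = 0`. -/
theorem normLawThree_of_klfUnit (hD : ∀ a b : Λ, D (a * b) = ι (aug a) * D b + D a * ι (aug b))
    (hι : ∀ x : 𝒪, ‖ι x‖ = ‖x‖) (hint : ∀ x : 𝒪, ‖x‖ ≤ 1)
    {I M : Type*} (Col : M → Λ) (u : I → M) (𝓛 U : I → Λ) (lam hyy logω : I → F) (ε ℓγ : F)
    (hklfU : ∀ i, Col (u i) = U i * 𝓛 i) (hU : ∀ i, IsUnit (U i)) (hL0 : ∀ i, aug (𝓛 i) = 0)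
    (hlaw : ∀ i, lam i * hyy i = ε * (ℓγ * D (Col (u i))) * logω i) (i : I) :
    ‖lam i‖ * ‖hyy i‖ = ‖ε‖ * ‖ℓγ * D (𝓛 i)‖ * ‖logω i‖ := by
  have h := congrArg (‖·‖) (hlaw i)
  simp only [norm_mul] at h
  rw [hklfU i, norm_deriv_mul_of_isUnit aug ι D hD hι hint (hU i) (𝓛 i) (hL0 i)] at h
  simpa [norm_mul] using h

/-- Instance of record for §3: `Λ = ℤ₂⟦T⟧`, `aug = [T⁰]`, `D = [T¹]` read in `ℚ₂`, `ι : ℤ₂ → ℚ₂`. Leibniz is §1's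
`coeff_one_mul`; `ι` is norm-preserving (`PadicInt.norm_def`). -/
theorem normLawThree_iwasawaTwo {I M : Type*}
    (Col : M → Literature.NumberTheory.EllipticCurves.IwasawaAlgebra 2) (u : I → M)
    (𝓛 U : I → Literature.NumberTheory.EllipticCurves.IwasawaAlgebra 2) (lam hyy logω : I → ℚ_[2]) (ε ℓγ : ℚ_[2])
    (hklfU : ∀ i, Col (u i) = U i * 𝓛 i) (hU : ∀ i, IsUnit (U i)) (hL0 : ∀ i, PowerSeries.constantCoeff (𝓛 i) = 0)
    (hlaw : ∀ i, lam i * hyy i = ε * (ℓγ * ((PowerSeries.coeff 1 (Col (u i)) : ℤ_[2]) : ℚ_[2])) * logω i) (i : I) :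
    ‖lam i‖ * ‖hyy i‖ = ‖ε‖ * ‖ℓγ * ((PowerSeries.coeff 1 (𝓛 i) : ℤ_[2]) : ℚ_[2])‖ * ‖logω i‖ := by
  refine normLawThree_of_klfUnit PowerSeries.constantCoeff (PadicInt.Coe.ringHom (p := 2))
    (fun f => ((PowerSeries.coeff 1 f : ℤ_[2]) : ℚ_[2])) ?_ ?_ PadicInt.norm_le_one Col u 𝓛 U lam hyy logω ε ℓγ
    hklfU hU hL0 hlaw i
  · intro a b
    change ((PowerSeries.coeff 1 (a * b) : ℤ_[2]) : ℚ_[2]) = _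
    rw [coeff_one_mul]
    push_cast
    rfl
  · intro x
    rw [PadicInt.norm_def]
    rfl

end NodeThree

/-! ## §4  Node (2)₂ and S2′ at unit grade: ONE out-of-range value per member, read through an `𝒪`-valued
evaluation `φ` (a continuous character of a pro-2 group is `𝒪`-valued on `Λ`; two variables allowed). -/
section NodeTwo

variable {Λ 𝒪 F : Type*} [CommRing Λ] [NormedCommRing 𝒪] [NormOneClass 𝒪] [NormMulClass 𝒪] [NormedField F]
variable (φ : Λ →+* 𝒪) (ι : 𝒪 →+* F)

/-- **GLUE (2)₂ at unit grade** — k2-g25's module law `lam(u) = E₂·logTw(u)` composed with the identification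
residue R175 WEAKENED to `Col(u_W) = U_W·(E·𝓛_W)`, `U_W ∈ Λˣ` member-dependent, `E` an explicit Euler / twisting
element: the member's VALUE law holds in norm with `E·𝓛_W` in place of `Col(u_W)`. -/
theorem normLawTwo_of_klfUnit (hι : ∀ x : 𝒪, ‖ι x‖ = ‖x‖) (hint : ∀ x : 𝒪, ‖x‖ ≤ 1)
    {I M : Type*} (Col : M → Λ) (u : I → M) (𝓛 U : I → Λ) (E : Λ) (logTw : I → F) (E₂ : F)
    (hklfU : ∀ i, Col (u i) = U i * (E * 𝓛 i)) (hU : ∀ i, IsUnit (U i))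
    (hlaw : ∀ i, ι (φ (Col (u i))) = E₂ * logTw i) (i : I) :
    ‖ι (φ (E * 𝓛 i))‖ = ‖E₂‖ * ‖logTw i‖ := by
  have h := congrArg (‖·‖) (hlaw i)
  simp only [norm_mul] at h
  rw [hklfU i, map_mul, map_mul, norm_mul, hι, norm_map_eq_one_of_isUnit φ hint (hU i), one_mul] at h
  rw [← h, map_mul]

/-- **S2′ is unit-grade in its measure.** The conclusion of `RubinValueFormulaAtTwoV11` reads the frame's measure
`G₂` only through `‖val‖`, `val = G₂(pt)`; for any `𝒪`-valued evaluation `ev` (a point of the open bidisk) and any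
`V ∈ Λ₂ˣ`, `‖ev(V·G₂)‖ = ‖ev G₂‖` — so the IDENTIFICATION of `G₂` among the generators of the characteristic
ideal (the MC clause `charIdeal = span {G₂}`) is never consumed beyond unit grade. -/
theorem normValue_generator_free (hint : ∀ x : 𝒪, ‖x‖ ≤ 1) (ev : Λ →+* 𝒪) {V : Λ} (hV : IsUnit V) (G : Λ) :
    ‖ev (V * G)‖ = ‖ev G‖ :=
  norm_map_mul_of_isUnit ev hint hV G

/-- Generators of the same principal ideal in a domain differ by a unit (the MC clause's currency). -/
theorem exists_unit_mul_of_span_singleton_eq {A : Type*} [CommRing A] [IsDomain A] {G G' : A}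
    (h : Ideal.span ({G} : Set A) = Ideal.span {G'}) : ∃ V : A, IsUnit V ∧ G' = V * G := by
  obtain ⟨u, hu⟩ := Ideal.span_singleton_eq_span_singleton.mp h
  exact ⟨u, u.isUnit, by rw [mul_comm]; exact hu.symm⟩

end NodeTwo

/-! ## §5  The honest one-sided weakest form, and the two-divisibilities converse -/
section OneSided

variable {Λ 𝒪 F : Type*} [CommRing Λ] [NormedCommRing 𝒪] [NormOneClass 𝒪] [NormMulClass 𝒪] [NormedField F]
variable (aug : Λ →+* 𝒪) (ι : 𝒪 →+* F) (D : Λ → F)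

omit [NormOneClass 𝒪] [NormMulClass 𝒪] in
/-- **(3)^≥ from ONE divisibility.** If the member's measure DIVIDES the Coleman image, `𝓛_W ∣ Col(u_W)` in `Λ`
(no unit required), then `‖[T¹]Col(u_W)‖ ≤ ‖𝓛′_W‖` — exactly the half `(3)^≥` that the LOWER child consumes
(k1-g16 `twoVal_ge_of_oneSided`); the opposite divisibility feeds only the UPPER half. -/
theorem norm_deriv_le_of_dvd (hD : ∀ a b : Λ, D (a * b) = ι (aug a) * D b + D a * ι (aug b))
    (hι : ∀ x : 𝒪, ‖ι x‖ = ‖x‖) (hint : ∀ x : 𝒪, ‖x‖ ≤ 1) {L C : Λ} (hdvd : L ∣ C) (hL : aug L = 0) :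
    ‖D C‖ ≤ ‖D L‖ := by
  obtain ⟨R, rfl⟩ := hdvd
  rw [mul_comm, deriv_mul_of_aug_eq_zero aug ι D hD R L hL, norm_mul, hι]
  exact mul_le_of_le_one_left (norm_nonneg _) (hint _)

omit [NormOneClass 𝒪] in
/-- Value node, one-sided: `L ∣ C` ⟹ `‖φ C‖ ≤ ‖φ L‖` for every `𝒪`-valued evaluation. -/
theorem norm_map_le_of_dvd (φ : Λ →+* 𝒪) (hint : ∀ x : 𝒪, ‖x‖ ≤ 1) {L C : Λ} (hdvd : L ∣ C) :
    ‖φ C‖ ≤ ‖φ L‖ := by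
  obtain ⟨R, rfl⟩ := hdvd
  rw [map_mul, norm_mul]
  exact mul_le_of_le_one_right (norm_nonneg _) (hint _)

/-- **Two divisibilities ⟹ unit grade** (in a domain, e.g. `ℤ₂⟦T⟧`, `𝒪⟦T₁,T₂⟧`): the EQUALITY `Col(u_W) = 𝓛_W`
is never needed — `𝓛_W ∣ Col(u_W)` and `Col(u_W) ∣ 𝓛_W` already give `Col(u_W) = U·𝓛_W`, `U ∈ Λˣ`. -/
theorem exists_unit_mul_of_dvd_dvd {A : Type*} [CommRing A] [IsDomain A] {L C : A} (h1 : L ∣ C) (h2 : C ∣ L) :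
    ∃ U : A, IsUnit U ∧ C = U * L := by
  obtain ⟨u, hu⟩ := associated_of_dvd_dvd h1 h2
  exact ⟨u, u.isUnit, by rw [mul_comm]; exact hu.symm⟩

/-- Instance of record: `ℤ₂⟦T⟧` is a domain, so the converse applies to `IwasawaAlgebra 2`. -/
example {L C : Literature.NumberTheory.EllipticCurves.IwasawaAlgebra 2} (h1 : L ∣ C) (h2 : C ∣ L) :
    ∃ U : Literature.NumberTheory.EllipticCurves.IwasawaAlgebra 2, IsUnit U ∧ C = U * L :=
  exists_unit_mul_of_dvd_dvd h1 h2

end OneSided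

/-! ## §5b  R175 at unit grade = PRIMITIVE MULTIPLICITY ONE (the (2)₂ identification on the unramified line
at `v`, weakest sufficient form).  Frame: `M` = the rank-one receptacle at `v` (k2-g25 / k3-g26: `H¹_Iw` of the
unramified `ℤ₂`-line with coefficients `T(key)`, modulo torsion), `f` = the frame's Coleman functional (R176 types
it), `g` = de Shalit's two-variable units map `i_∞` twisted and DESCENDED to the line at `v` (R191′).  Unit grade
asks only `f = U·g`, `U ∈ Λ_vˣ`; it follows from CYCLICITY of `M` + SURJECTIVITY of both functionals, or — the
form insensitive to pseudo-null (finite-index) defects such as de Shalit's anomalous cokernel `(𝒪_K/p^N)(1)`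
(I.3.7 (13)) and the finite `H_•(H_v, ℤ₂(ρ_key))` of the descent — from `f = r·g` + TWO COPRIME VALUES of `f`. -/
section MultiplicityOne

variable {Λ M : Type*} [CommRing Λ] [AddCommGroup M] [Module Λ M]

/-- A surjective functional takes a unit value on any cyclic generator. -/
theorem isUnit_apply_generator_of_surjective (f : M →ₗ[Λ] Λ) (hf : Function.Surjective f)
    {m : M} (hm : ∀ x : M, ∃ a : Λ, x = a • m) : IsUnit (f m) := by
  obtain ⟨x, hx⟩ := hf 1
  obtain ⟨a, rfl⟩ := hm x
  rw [map_smul, smul_eq_mul] at hx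
  exact IsUnit.of_mul_eq_one_right a hx

/-- **H5 (primitive multiplicity one ⟹ unit grade).** On a CYCLIC module two SURJECTIVE functionals differ by a
unit: `∃ U ∈ Λˣ, f = U·g`.  (N2′ «multiplicity one» gives `f = r·g` with `r ∈ Frac Λ`; primitivity of both pins
`r` to `Λˣ` — and `Λˣ` is all the (2)₂ node consumes, §4.) -/
theorem exists_unit_mul_of_surjective_of_cyclic (f g : M →ₗ[Λ] Λ) (hf : Function.Surjective f)
    (hg : Function.Surjective g) {m : M} (hm : ∀ x : M, ∃ a : Λ, x = a • m) :
    ∃ U : Λ, IsUnit U ∧ ∀ x : M, f x = U * g x := by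
  have hb : IsUnit (g m) := isUnit_apply_generator_of_surjective g hg hm
  obtain ⟨bu, hbu⟩ := hb
  refine ⟨f m * ↑bu⁻¹, (isUnit_apply_generator_of_surjective f hf hm).mul (Units.isUnit _), fun x => ?_⟩
  obtain ⟨a, rfl⟩ := hm x
  rw [map_smul, map_smul, smul_eq_mul, smul_eq_mul, ← hbu]
  calc a * f m = a * f m * (↑bu⁻¹ * ↑bu) := by rw [Units.inv_mul, mul_one]
    _ = f m * ↑bu⁻¹ * (a * ↑bu) := by ring

/-- **H5′ (pseudo-null insensitivity, elementary form).** If `f = r·g` for some `r ∈ Λ` (multiplicity one with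
an INTEGRAL ratio — e.g. `g` generates the dual) and `f` takes two COPRIME values (its image has finite index:
it contains a power of `2` and a power of a distinguished polynomial), then `r` is a unit.  Finite cokernels —
de Shalit's `(𝒪_K/p^N)(1)`, the `{±1}`-homology of the descent at `p = 2` — never cost a unit-grade digit. -/
theorem isUnit_ratio_of_isRelPrime_values (f g : M →ₗ[Λ] Λ) (r : Λ) (h : ∀ x : M, f x = r * g x)
    {x y : M} (hxy : IsRelPrime (f x) (f y)) : IsUnit r :=
  hxy (Dvd.intro _ (h x).symm) (Dvd.intro _ (h y).symm)

/-- Symmetric bookkeeping: if also `g = s·f` then `(r·s − 1)` kills every value of `f`; on a value that is a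
non-zero-divisor this forces `r·s = 1` (multiplicity one in BOTH directions is already unit grade). -/
theorem mul_ratio_eq_one_of_both_ways (f g : M →ₗ[Λ] Λ) (r s : Λ) (h : ∀ x : M, f x = r * g x)
    (h' : ∀ x : M, g x = s * f x) {x : M} (hx : f x ∈ nonZeroDivisors Λ) : r * s = 1 := by
  have e : (r * s - 1) * f x = 0 := by
    have := h x
    rw [h' x] at this
    linear_combination (-1 : Λ) * this
  exact sub_eq_zero.mp ((mul_right_mem_nonZeroDivisors_eq_zero_iff hx).mp e)

end MultiplicityOne

/-! ## §6  Digit shadows over `ℤ` (valuation bookkeeping of the NON-unit factors that survive unit grade) -/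
section Digits

/-- Euler digits at the étale prime for `β = ψ_A(𝔮) ≡ 3 (mod 8)` (k1-g25 `beta_digit`: `β ≡ 27 (mod 64)`):
`v₂(1 − β) = 1` and `v₂(1 + β) = 2` — the two χ₅-partner keys (`β ↦ −β`) differ by EXACTLY one at this factor. -/
theorem eulerDigits_of_beta_mod_eight (β : ℤ) (hβ : β % 8 = 3) :
    (2 ∣ 1 - β ∧ ¬ 4 ∣ 1 - β) ∧ (4 ∣ 1 + β ∧ ¬ 8 ∣ 1 + β) := by
  omega

/-- The χ₅-partner involution `β ↦ −β` swaps the two factors: `1 − (−β) = 1 + β`, `1 + (−β) = 1 − β`. -/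
theorem eulerDigits_partner (β : ℤ) : (1 - (-β) = 1 + β) ∧ (1 + (-β) = 1 - β) := by
  constructor <;> ring

/-- **Budget transport between partner keys.**  Arm M″'s per-key budget is `2·eC + eM ≤ eA + 1` (k1-g16
`lower_of_triangle_explicit`).  If the three keyed constants of the partner key are the anchored key's plus
explicit shifts `σA, σC, σM`, the partner's budget follows from the anchored one as soon as `σA ≥ 2σC + σM`. -/
theorem budget_transport {eA eC eM σA σC σM : ℤ} (hanchor : 2 * eC + eM ≤ eA + 1)
    (hshift : 2 * σC + σM ≤ σA) : 2 * (eC + σC) + (eM + σM) ≤ (eA + σA) + 1 := by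
  omega

/-- Conversely the transport FAILS by exactly the deficit: if `σA < 2σC + σM − s` where `s` is the anchored key's
slack, the partner budget is not implied (witness). -/
theorem budget_transport_sharp :
    ∃ eA eC eM σA σC σM : ℤ, 2 * eC + eM ≤ eA + 1 ∧ σA = 2 * σC + σM - 1 ∧
      ¬ 2 * (eC + σC) + (eM + σM) ≤ (eA + σA) + 1 := by
  refine ⟨1, 1, 0, 1, 1, 0, by norm_num, by norm_num, by norm_num⟩

end Digits

/-! ## §7  Anti-costume: every hypothesis of the lever is load-bearing -/
section Witnesses

/-- Without the rank-one vanishing `f(𝟙) = 0` a unit DOES move the first Taylor coefficient: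
`U = 1 + T ∈ ℤ⟦T⟧ˣ`, `f = 1`: `[T¹](U·f) = 1 ≠ 0 = U(𝟙)·[T¹]f`. -/
theorem rankOne_hypothesis_needed :
    coeff 1 (((1 : ℤ⟦X⟧) + X) * 1) = 1 ∧ constantCoeff ((1 : ℤ⟦X⟧) + X) * coeff 1 (1 : ℤ⟦X⟧) = 0 := by
  constructor
  · simp [coeff_one_X]
  · simp

/-- `1 + T` is indeed a unit of `ℤ⟦T⟧` (constant coefficient `1`). -/
theorem one_add_X_isUnit : IsUnit ((1 : ℤ⟦X⟧) + X) := by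
  rw [PowerSeries.isUnit_iff_constantCoeff]
  simp

/-- Without `IsUnit U` the norm DOES move: rescaling by the non-unit constant `2 ∈ ℤ₂` halves every value
(`‖2‖₂ = 2⁻¹`), which in the `m = 2·v₂` currency is the full parity unit — unit grade absorbs Gauss-sum SIGNS,
orientations `(ζ_n)`, the choice of `γ`, `D_crys`-bases of unramified characters, but never a power of `2`. -/
theorem unit_hypothesis_needed : ‖((2 : ℕ) : ℤ_[2])‖ = ((2 : ℕ) : ℝ)⁻¹ :=
  PadicInt.norm_p

/-- And `2` is not a unit of `ℤ₂`. -/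
theorem two_not_isUnit : ¬ IsUnit ((2 : ℕ) : ℤ_[2]) := by
  rw [PadicInt.isUnit_iff, unit_hypothesis_needed]
  norm_num

end Witnesses

end Summit.BirchSwinnertonDyer.BirchSwinnertonDyer.Cruxes.SplitBadTwoLowerHalfOfFacts.StubIdeasK1G26
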